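import Summits.BirchSwinnertonDyer.BirchSwinnertonDyer.Theorems.ManinLocalTwoThreePShiftEigenBase
import Summits.BirchSwinnertonDyer.BirchSwinnertonDyer.Theorems.ManinLocalTwoThreePShiftStepEigenFermat
import Summits.BirchSwinnertonDyer.BirchSwinnertonDyer.Theorems.ManinLocalTwoThreePShiftStepHeisenbergEigen
import Summits.BirchSwinnertonDyer.BirchSwinnertonDyer.Theorems.ManinLocalTwoThreePShiftEqualiserAllLevels
import HarnessLib

/-!
# The prime-generic EIGEN law `K^ε_p(N) = 0` at every level (`p ≥ 5`, `ε ≠ 0, 1`) and the `p²`-SHIFT equaliser law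
# (route `ManinLocalTwoThree`, cell bsd-f2-manin; cruxes C2 stmt-BirchSwinnertonDyer-22967 / C3 stmt-…-22968; LEAD seat p1 gen 12)

* **`shiftEigenTrivialAtP_all`**: for every prime `p ≥ 5`, every `ε ∈ ℤ/p ∖ {0, 1}` and every `N ≥ 1`, an additive `φ : Γ₀(N) → ℤ/p`
  with `φ(a, pb; c, d) = ε·φ(a, b; pc, d)` on `Γ₀(pN)` VANISHES (`ker(π_p^* − ε π_1^*) = 0` on `H¹(Γ₀(N), 𝔽_p)`, Eisenstein part
  included, every `p`-adic valuation of `N`).  Strong induction down the `p`-adic tower: base `p ∤ N` (p2's Serre rigidity, file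
  `…PShiftEigenBase`), transfer at `p ∥ N` (`shiftEigenTrivialAtP_mul`), engine + es's explicit-pair argument at `p² ∥ N`
  (`stepEigen_of_not_dvd`), engine + Heisenberg at `p³ ∣ N` (`stepEigen_of_dvd`).  (`p = 3`, `ε = −1`: es's E-es-95/E-es-106, tree
  theorems of the seat's g11; `p = 2`: p3's eigen tower.)
* **`sqShiftInvariantIsDiamondAt_all`** — the `p²`-SHIFT LAW: for `p ≥ 5` and every `N ≥ 1`, every additive `φ : Γ₀(N) → ℤ/p` invariant
  under the `p²`-shift `γ ↦ diag(p²,1) γ diag(p²,1)⁻¹` on `Γ₀(p²N)` is a diamond class (`ShiftEqualiser.ShiftInvariantIsDiamondAt (ZMod p) (p²) N`;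
  the `p`-generic E-es-94♯): the defect `ψ = π_p^*φ − π_1^*φ` on `Γ₀(pN)` is a `(−1)`-eigenfunction, hence `0`, so `φ` is `p`-shift
  invariant and the law `K_p = D` (file `…PShiftEqualiserAllLevels`) applies.
Nothing about BSD, Manin's conjecture or C2/C3 is proved here (structure theorems about `Γ₀(N)`).
[cite: DarmonDiamondTaylor1995, Lemma 4.28 (p. 135) (shape: the degeneracy maps on `Γ₀`; the `p ∣ N` laws are the cell's)]
-/

set_option autoImplicit false
set_option linter.dupNamespace false

open scoped MatrixGroups

open CongruenceSubgroup Matrix.SpecialLinearGroup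
  Summit.BirchSwinnertonDyer.Rank1Residual.ManinAdditive.NineShiftEqualiser

namespace Summit.BirchSwinnertonDyer.BirchSwinnertonDyer.Theorems.ManinLocalTwoThree

namespace PShiftEngine

open ThreeShiftDescent TwoShift PShiftTransfer
open Summit.BirchSwinnertonDyer.Rank1Residual.ManinAdditive

variable {p : ℕ} [Fact p.Prime]

/-! ### §1. The eigen law at every level -/

/-- **`K^ε_p(N) = 0` for every `N ≥ 1`, every prime `p ≥ 5`, every `ε ≠ 0, 1`** (coefficients `ℤ/p`). [new: assembly] -/
theorem shiftEigenTrivialAtP_all (h5 : 5 ≤ p) {ε : ZMod p} (hε0 : ε ≠ 0) (hε1 : ε ≠ 1) :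
    ∀ N : ℕ, 0 < N → ShiftEigenTrivialAtP p N ε := by
  have hp : p.Prime := Fact.out
  have hp2 : p ≠ 2 := by omega
  intro N
  induction N using Nat.strong_induction_on with
  | _ N ih =>
    intro hN
    by_cases hpN : p ∣ N
    · obtain ⟨M, rfl⟩ := hpN
      have hM : 0 < M := Nat.pos_of_mul_pos_left hN
      by_cases hpM : p ∣ M
      · obtain ⟨m, rfl⟩ := hpM
        have hm : 0 < m := Nat.pos_of_mul_pos_left hM
        have hlt : p * m < p * (p * m) := by
          have : 1 * (p * m) < p * (p * m) := Nat.mul_lt_mul_of_pos_right (by omega) hM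
          simpa using this
        have hbase : ShiftEigenTrivialAtP p (p * m) ε := ih (p * m) hlt hM
        by_cases hpm : p ∣ m
        · exact stepEigen_of_dvd h5 hm hpm hε0 hbase
        · exact stepEigen_of_not_dvd hp2 hm hpm hε0 hε1 hbase
      · exact shiftEigenTrivialAtP_prime_mul h5 hM hpM hε1
    · exact shiftEigenTrivialAtP_of_not_dvd hN hpN hε1

/-! ### §2. The `p²`-shift law -/

section SqShift

variable {N : ℕ}

omit [Fact p.Prime] in
/-- The degeneracy conjugation `diag(1,1)` (inclusion `Γ₀(pN) ≤ Γ₀(N)`) on an explicit matrix. [folklore] -/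
theorem degeneracyConj_one_g0Of (a b c d : ℤ) (hdet : a * d - b * c = 1) (hc : ((p * N : ℕ) : ℤ) ∣ c) (hcN : (N : ℤ) ∣ c) :
    Literature.NumberTheory.EllipticCurves.ModularForms.Gamma0.degeneracyConj N (p * N) 1 ⟨p, by ring⟩ (g0Of a b c d hdet hc) =
      g0Of a b c d hdet hcN := by
  apply Subtype.ext
  rw [Literature.NumberTheory.EllipticCurves.ModularForms.Gamma0.coe_degeneracyConj_one]
  rfl

/-- The degeneracy conjugation `diag(p,1)` on an explicit matrix `(a b; pc₀ d) ↦ (a, pb; c₀, d)`. [folklore] -/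
theorem degeneracyConj_p_g0Of (a b c₀ d : ℤ) (hdet : a * d - b * (p * c₀) = 1) (hc : ((p * N : ℕ) : ℤ) ∣ p * c₀) (hcN : (N : ℤ) ∣ c₀) :
    haveI : NeZero p := ⟨(Fact.out : p.Prime).ne_zero⟩
    Literature.NumberTheory.EllipticCurves.ModularForms.Gamma0.degeneracyConj N (p * N) p ⟨1, by ring⟩ (g0Of a b (p * c₀) d hdet hc) =
      g0Of a (p * b) c₀ d (by linear_combination hdet) hcN := by
  have hp : p.Prime := Fact.out
  apply Subtype.ext
  ext i j
  fin_cases i <;> fin_cases j <;>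
    simp [Literature.NumberTheory.EllipticCurves.ModularForms.Gamma0.degeneracyConj_apply, g0Of, slOf,
      Int.mul_ediv_cancel_left _ (show (p : ℤ) ≠ 0 by exact_mod_cast hp.ne_zero)]

/-- `−1 ≠ 1` in `ℤ/p` for `p ≥ 3`. [folklore] -/
theorem neg_one_ne_one_zmod (h3 : 3 ≤ p) : (-1 : ZMod p) ≠ 1 := by
  intro h
  have h2 : ((2 : ℕ) : ZMod p) = 0 := by rw [Nat.cast_ofNat]; linear_combination -h
  rw [ZMod.natCast_eq_zero_iff] at h2
  have := Nat.le_of_dvd (by norm_num) h2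
  omega

/-- **`p²`-shift invariance implies `p`-shift invariance** (`p ≥ 5`, `N ≥ 1`, coefficients `ℤ/p`): the defect
`ψ = φ∘diag(p,1) − φ` on `Γ₀(pN)` is an additive `(−1)`-eigenfunction of the `p`-shift, hence `0` by `shiftEigenTrivialAtP_all`. [new] -/
theorem isShiftInvariant_of_sq (h5 : 5 ≤ p) (hN : 0 < N) (φ : Gamma0 N → ZMod p) (hadd : ShiftEqualiser.IsAdd φ)
    (hinv : ShiftEqualiser.IsShiftInvariant (((p ^ 2 : ℕ) : ℤ)) φ) : ShiftEqualiser.IsShiftInvariant (p : ℤ) φ := by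
  have hp : p.Prime := Fact.out
  haveI : NeZero p := ⟨hp.ne_zero⟩
  set δp := Literature.NumberTheory.EllipticCurves.ModularForms.Gamma0.degeneracyConj N (p * N) p ⟨1, by ring⟩ with hδp
  set δ1 := Literature.NumberTheory.EllipticCurves.ModularForms.Gamma0.degeneracyConj N (p * N) 1 ⟨p, by ring⟩ with hδ1
  set ψ : Gamma0 (p * N) → ZMod p := fun γ => φ (δp γ) - φ (δ1 γ) with hψ
  have hψadd : IsAdd ψ := by
    intro γ δ
    simp only [hψ, map_mul, hadd (δp γ) (δp δ), hadd (δ1 γ) (δ1 δ)]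
    ring
  have hψeig : IsShiftEigenP p (-1 : ZMod p) ψ := by
    intro a b c d hdet hc
    obtain ⟨c₀, rfl⟩ : (p : ℤ) ∣ c := dvd_trans ⟨(N : ℤ), by push_cast; ring⟩ hc
    have hcN : (N : ℤ) ∣ c₀ := by
      have h := hc; push_cast at h
      exact Int.dvd_of_mul_dvd_mul_left (by exact_mod_cast hp.ne_zero) h
    have hpc : ((p * N : ℕ) : ℤ) ∣ p * (p * c₀) := Dvd.dvd.mul_left hc p
    -- the four conjugates
    have e1 : δp (g0Of a (p * b) (p * c₀) d (by linear_combination hdet) hc) =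
        g0Of a (p * (p * b)) c₀ d (by linear_combination hdet) hcN := degeneracyConj_p_g0Of a (p * b) c₀ d _ hc hcN
    have e2 : δ1 (g0Of a (p * b) (p * c₀) d (by linear_combination hdet) hc) =
        g0Of a (p * b) (p * c₀) d (by linear_combination hdet) (Dvd.dvd.mul_left hcN p) := degeneracyConj_one_g0Of _ _ _ _ _ hc _
    have e3 : δp (g0Of a b (p * (p * c₀)) d hdet hpc) = g0Of a (p * b) (p * c₀) d (by linear_combination hdet) (Dvd.dvd.mul_left hcN p) :=
      degeneracyConj_p_g0Of a b (p * c₀) d hdet hpc _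
    have e4 : δ1 (g0Of a b (p * (p * c₀)) d hdet hpc) = g0Of a b (p * (p * c₀)) d hdet (Dvd.dvd.mul_left (Dvd.dvd.mul_left hcN p) p) :=
      degeneracyConj_one_g0Of _ _ _ _ _ hpc _
    -- `p²`-shift invariance applied to `(a, b; c₀, d)`
    have key := hinv a b c₀ d (by push_cast; linear_combination hdet) hcN
    have key' : φ (g0Of a (p * (p * b)) c₀ d (by linear_combination hdet) hcN) =
        φ (g0Of a b (p * (p * c₀)) d hdet (Dvd.dvd.mul_left (Dvd.dvd.mul_left hcN p) p)) := by
      convert key using 2 <;> exact g0Of_congr rfl (by push_cast; ring) (by push_cast; ring) rfl _ _ _ _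
    simp only [hψ]
    rw [e1, e2, e3, e4, key']
    ring
  have hψ0 := shiftEigenTrivialAtP_all h5 (ε := (-1 : ZMod p)) (neg_ne_zero.mpr one_ne_zero) (neg_one_ne_one_zmod (by omega))
    (p * N) (Nat.mul_pos hp.pos hN) ψ hψadd hψeig
  intro a b c d hdet hc
  have hpc : ((p * N : ℕ) : ℤ) ∣ p * c := by push_cast; exact mul_dvd_mul_left (p : ℤ) hc
  have h0 := hψ0 (g0Of a b (p * c) d hdet hpc)
  simp only [hψ] at h0
  rw [degeneracyConj_p_g0Of a b c d hdet hpc hc, degeneracyConj_one_g0Of a b (p * c) d hdet hpc (Dvd.dvd.mul_left hc p)] at h0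
  exact sub_eq_zero.mp h0

/-- **THE `p²`-SHIFT EQUALISER LAW (`p ≥ 5`, every level `N ≥ 1`)**: every additive `φ : Γ₀(N) → ℤ/p` invariant under the `p²`-shift on
`Γ₀(p²N)` is a diamond class — `ker(π₁^* − π_{p²}^*) = Hom((ℤ/N)ˣ, 𝔽_p) ∘ d` on `H¹(Γ₀(N), 𝔽_p)`. [new: the `p`-generic E-es-94♯] -/
theorem sqShiftInvariantIsDiamondAt_all (h5 : 5 ≤ p) (N : ℕ) (hN : 0 < N) :
    ShiftEqualiser.ShiftInvariantIsDiamondAt (ZMod p) ((p ^ 2 : ℕ) : ℤ) N := fun φ hadd hinv =>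
  shiftInvariantIsDiamondAt_all h5 N hN φ hadd (isShiftInvariant_of_sq h5 hN φ hadd hinv)

end SqShift

end PShiftEngine

end Summit.BirchSwinnertonDyer.BirchSwinnertonDyer.Theorems.ManinLocalTwoThree
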